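import Summits.Ventures.GridStability.Models.PortHamiltonianSpectrum
import HarnessLib

/-!
# GridStability/Lyapunov/LocalSyncSpectrum — the GYROSCOPIC spectral lemma of the local synchronisation form (G2-SCALE cell T-row T7; idea-2 cycle-2 card «local-sync-form-edge-gain-certificate» P1 + P2)

Venture GRIDFUSION, G2-SCALE cell (lead g19 §39 D50 T7; crit-1 literal-typing confirmation STATUS 2026-08-28T18:41Z; placement agreed with
lit-4 g14), seat gridfusion-sos-5 (g10). GENERIC linear algebra, no model, no data.

`D̂ ẇ = −η (Q + 𝒥) w` with `Q` real, `𝒥` real SKEW, `D̂ ≻ 0`, a common null vector `ρ` (`(Q + 𝒥)ρ = 0`),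
and `Q ≻ 0` (as a quadratic form) on the `D̂`-orthogonal complement of `ρ` ⇒ every complex solution of the pencil
`(Q + 𝒥)v = −μ D̂ v`, `v ≠ 0`, has `Re μ < 0` or (`μ = 0` and `v ∈ ℂρ`), and `0` carries NO Jordan chain (`(Q + 𝒥)u = c·D̂ρ ⇒ c = 0 ∧ u ∈ ℝρ`,
`eq_zero_of_generalized_null`). The skew part never has to be certified, and the symmetry of `Q` is not used (only its
quadratic form). P2: the subspace hypothesis from ONE reduced positive definite matrix
`Zᵀ Q Z` (any `Z` with `dᵀZ = 0`, `d := D̂ρ`, and `#cols + 1 = #rows`; injectivity of `Z` follows from the certificate itself,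
so `range Z = d^⊥` by a dimension count).
THREE COLUMNS: pure linear algebra over `ℝ`/`ℂ`; no model, no data; nothing here says a converter or a grid is stable.
-/

noncomputable section

open Matrix Finset
open scoped ComplexOrder ComplexConjugate

namespace Summit.Ventures.GridStability.Lyapunov

open Summit.Ventures.GridStability.Models

variable {ι : Type*} [Fintype ι] [DecidableEq ι]

omit [DecidableEq ι] in
/-- Real part of the Hermitian form of a REAL matrix on a complex vector `w = a + ib`: `Re(w* M w) = aᵀMa + bᵀMb`
(no symmetry needed). [folklore] -/
theorem re_star_dotProduct_map_mulVec (M : Matrix ι ι ℝ) (w : ι → ℂ) :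
    (star w ⬝ᵥ (M.map ((↑) : ℝ → ℂ) *ᵥ w)).re
      = (fun i => (w i).re) ⬝ᵥ (M *ᵥ fun i => (w i).re)
        + (fun i => (w i).im) ⬝ᵥ (M *ᵥ fun i => (w i).im) := by
  simp only [dotProduct, Matrix.mulVec, Pi.star_apply, Finset.mul_sum, Complex.re_sum, ← Finset.sum_add_distrib]
  refine Finset.sum_congr rfl fun i _ => Finset.sum_congr rfl fun j _ => ?_
  simp only [Matrix.map_apply, Complex.mul_re, Complex.mul_im, Complex.star_def, Complex.conj_re, Complex.conj_im,
    Complex.ofReal_re, Complex.ofReal_im]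
  ring

omit [DecidableEq ι] in
/-- `M` positive (as a quadratic form) on the real hyperplane `d^⊥` ⇒ `Re(w* M w) > 0` for every nonzero COMPLEX `w` with
`Σ dᵢwᵢ = 0` (apply the real hypothesis to the real and imaginary parts). [folklore] -/
theorem re_star_dotProduct_map_mulVec_pos_of_posDefOn {M : Matrix ι ι ℝ} {d : ι → ℝ}
    (hpos : ∀ u : ι → ℝ, d ⬝ᵥ u = 0 → u ≠ 0 → 0 < u ⬝ᵥ (M *ᵥ u))
    {w : ι → ℂ} (hw : w ≠ 0) (horth : ∑ i, (d i : ℂ) * w i = 0) :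
    0 < (star w ⬝ᵥ (M.map ((↑) : ℝ → ℂ) *ᵥ w)).re := by
  rw [re_star_dotProduct_map_mulVec]
  set a : ι → ℝ := fun i => (w i).re with ha
  set b : ι → ℝ := fun i => (w i).im with hb
  have hda : d ⬝ᵥ a = 0 := by
    have h := congr_arg Complex.re horth
    simpa [Complex.re_sum, Complex.mul_re, dotProduct, a] using h
  have hdb : d ⬝ᵥ b = 0 := by
    have h := congr_arg Complex.im horth
    simpa [Complex.im_sum, Complex.mul_im, dotProduct, b] using h
  have hab : a ≠ 0 ∨ b ≠ 0 := by
    by_contra h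
    push Not at h
    apply hw
    funext i
    apply Complex.ext
    · simpa [a] using congr_fun h.1 i
    · simpa [b] using congr_fun h.2 i
  have ha0 : 0 ≤ a ⬝ᵥ (M *ᵥ a) := by
    by_cases h : a = 0
    · simp [h]
    · exact (hpos a hda h).le
  have hb0 : 0 ≤ b ⬝ᵥ (M *ᵥ b) := by
    by_cases h : b = 0
    · simp [h]
    · exact (hpos b hdb h).le
  rcases hab with h | h
  · have := hpos a hda h
    linarith
  · have := hpos b hdb h
    linarith

/-- **The gyroscopic spectral lemma (pencil form, one real matrix).** `M` real, `D ≻ 0` real, `Mρ = 0`, and the quadratic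
form of `M` positive on `{u | (Dρ)ᵀu = 0}` ⇒ every complex solution of `M v = −μ·D v` with `v ≠ 0` has `Re μ < 0`, or
`μ = 0` with `v` a complex multiple of `ρ`. Proof: split `v = ṽ + cρ` with `(Dρ)ᵀṽ = 0`; then `Mṽ = −μ D v`,
`ṽ*Mṽ = −μ·ṽ*Dṽ` (the cross term `ṽ*Dρ` vanishes), and `Re ṽ*Mṽ = aᵀMa + bᵀMb > 0` unless `ṽ = 0`. [folklore] -/
theorem re_eig_neg_or_zero_of_posDefOn {M D : Matrix ι ι ℝ} (hD : D.PosDef) {ρ : ι → ℝ} (hρ : M *ᵥ ρ = 0)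
    (hpos : ∀ u : ι → ℝ, (D *ᵥ ρ) ⬝ᵥ u = 0 → u ≠ 0 → 0 < u ⬝ᵥ (M *ᵥ u))
    {μ : ℂ} {v : ι → ℂ} (hv : v ≠ 0)
    (hev : M.map ((↑) : ℝ → ℂ) *ᵥ v = -(μ • (D.map ((↑) : ℝ → ℂ) *ᵥ v))) :
    μ.re < 0 ∨ (μ = 0 ∧ ∃ c : ℂ, v = c • fun i => (ρ i : ℂ)) := by
  set Mc : Matrix ι ι ℂ := M.map ((↑) : ℝ → ℂ) with hMc
  set Dc : Matrix ι ι ℂ := D.map ((↑) : ℝ → ℂ) with hDc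
  set ρc : ι → ℂ := fun i => (ρ i : ℂ) with hρc
  set d : ι → ℝ := D *ᵥ ρ with hd
  set dc : ι → ℂ := fun i => (d i : ℂ) with hdcdef
  -- plumbing: casts of `Dρ` and `Mρ`
  have hdc : Dc *ᵥ ρc = dc := by
    funext i
    rw [map_ofReal_mulVec_apply]
    simp only [dc, d, Matrix.mulVec, dotProduct, ρc]
    push_cast
    rfl
  have hMρ : Mc *ᵥ ρc = 0 := by
    funext i
    have h := congr_fun hρ i
    simp only [Matrix.mulVec, dotProduct, Pi.zero_apply] at h
    rw [map_ofReal_mulVec_apply, Pi.zero_apply]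
    simp only [ρc]
    exact_mod_cast h
  -- the projection coefficient
  set s : ℂ := ∑ i, dc i * ρc i with hs
  set c : ℂ := (∑ i, dc i * v i) / s with hc
  set vt : ι → ℂ := v - c • ρc with hvt
  have hs_real : s = ((ρ ⬝ᵥ (D *ᵥ ρ) : ℝ) : ℂ) := by
    simp only [s, dc, d, ρc, dotProduct]
    push_cast
    exact Finset.sum_congr rfl fun i _ => by ring
  -- (i) `Σ dᵢ ṽᵢ = 0`
  have horth : ∑ i, dc i * vt i = 0 := by
    by_cases hs0 : s = 0
    · -- then ρᵀDρ = 0, so ρ = 0 and d = 0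
      have hρ0 : ρ = 0 := by
        by_contra hne
        have hp : 0 < star ρ ⬝ᵥ (D *ᵥ ρ) := hD.dotProduct_mulVec_pos hne
        rw [star_trivial] at hp
        rw [hs_real] at hs0
        have : ρ ⬝ᵥ (D *ᵥ ρ) = 0 := by exact_mod_cast hs0
        linarith
      have hd0 : ∀ i, dc i = 0 := by
        intro i
        simp [dc, d, hρ0]
      exact Finset.sum_eq_zero fun i _ => by rw [hd0 i, zero_mul]
    · have h1 : ∑ i, dc i * vt i = (∑ i, dc i * v i) - c * s := by
        simp only [vt, Pi.sub_apply, Pi.smul_apply, smul_eq_mul, mul_sub, Finset.sum_sub_distrib, s,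
          Finset.mul_sum]
        congr 1
        exact Finset.sum_congr rfl fun i _ => by ring
      rw [h1, hc, div_mul_cancel₀ _ hs0, sub_self]
  -- (ii) the pencil equation for ṽ
  have hev' : Mc *ᵥ vt = -(μ • (Dc *ᵥ v)) := by
    rw [hvt, Matrix.mulVec_sub, Matrix.mulVec_smul, hMρ, smul_zero, sub_zero, hev]
  -- (iii) the cross term vanishes: ṽ*(Dρ) = 0
  have hcross : star vt ⬝ᵥ (Dc *ᵥ ρc) = 0 := by
    rw [hdc]
    have h1 : star vt ⬝ᵥ dc = conj (∑ i, dc i * vt i) := by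
      simp only [dotProduct, Pi.star_apply, map_sum, map_mul, dc, Complex.conj_ofReal, Complex.star_def]
      exact Finset.sum_congr rfl fun i _ => by ring
    rw [h1, horth, map_zero]
  have hDv : star vt ⬝ᵥ (Dc *ᵥ v) = star vt ⬝ᵥ (Dc *ᵥ vt) := by
    have h1 : Dc *ᵥ v = Dc *ᵥ vt + c • (Dc *ᵥ ρc) := by
      rw [hvt, Matrix.mulVec_sub, Matrix.mulVec_smul, sub_add_cancel]
    rw [h1, dotProduct_add, dotProduct_smul, hcross, smul_zero, add_zero]
  -- (iv) key identity  ṽ*Mṽ = −μ · ṽ*Dṽ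
  have hkey : star vt ⬝ᵥ (Mc *ᵥ vt) = -(μ * (star vt ⬝ᵥ (Dc *ᵥ vt))) := by
    rw [hev', dotProduct_neg, dotProduct_smul, smul_eq_mul, hDv]
  -- real parts
  set p : ℂ := star vt ⬝ᵥ (Dc *ᵥ vt) with hp
  have hp0 : 0 ≤ p := dotProduct_map_ofReal_mulVec_nonneg hD.posSemidef vt
  obtain ⟨hpre, hpim⟩ := Complex.nonneg_iff.1 hp0
  have hre := congr_arg Complex.re hkey
  rw [Complex.neg_re, Complex.mul_re, ← hpim, mul_zero, sub_zero] at hre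
  -- hre : (ṽ*Mṽ).re = -(μ.re * p.re)
  by_cases hvt0 : vt = 0
  · -- v = cρ and μ = 0
    right
    have hvc : v = c • ρc := by
      have : v - c • ρc = 0 := by rw [← hvt]; exact hvt0
      exact sub_eq_zero.1 this
    refine ⟨?_, c, hvc⟩
    by_contra hμ
    have h0 : μ • (Dc *ᵥ v) = 0 := by
      have h1 := hev'
      rw [hvt0, Matrix.mulVec_zero] at h1
      exact neg_eq_zero.1 h1.symm
    rcases smul_eq_zero.1 h0 with h | h
    · exact hμ h
    · have hq : 0 < star v ⬝ᵥ (Dc *ᵥ v) := dotProduct_map_ofReal_mulVec_pos hD hv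
      rw [h, dotProduct_zero] at hq
      exact lt_irrefl _ hq
  · -- ṽ ≠ 0: both forms positive
    left
    have hppos : 0 < p := dotProduct_map_ofReal_mulVec_pos hD hvt0
    obtain ⟨hpre', -⟩ := Complex.pos_iff.1 hppos
    have hq : 0 < (star vt ⬝ᵥ (Mc *ᵥ vt)).re :=
      re_star_dotProduct_map_mulVec_pos_of_posDefOn hpos hvt0 horth
    rw [hre] at hq
    by_contra hμ
    push Not at hμ
    have : 0 ≤ μ.re * p.re := mul_nonneg hμ hpre'.le
    linarith

omit [DecidableEq ι] in
/-- **No generalized null vector (algebraic simplicity of the zero mode), one real matrix.** `M` real, `D ≻ 0`, `ρ ≠ 0`,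
`Mρ = 0`, quadratic form of `M` positive on `{u | (Dρ)ᵀu = 0}`: if `M u = c·Dρ` for a REAL `u` then `c = 0` and `u ∈ ℝρ` —
so `0` carries no Jordan chain for the pencil `(M, D)` (a chain `M w = −D ρ` is excluded). Proof: split `u = ũ + aρ` with
`(Dρ)ᵀũ = 0`; `ũᵀMũ = c·ũᵀDρ = 0` forces `ũ = 0`, then `c·Dρ = 0` forces `c = 0`. [folklore] -/
theorem eq_zero_of_generalized_null_of_posDefOn {M D : Matrix ι ι ℝ} (hD : D.PosDef) {ρ : ι → ℝ} (hρ0 : ρ ≠ 0)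
    (hρ : M *ᵥ ρ = 0) (hpos : ∀ u : ι → ℝ, (D *ᵥ ρ) ⬝ᵥ u = 0 → u ≠ 0 → 0 < u ⬝ᵥ (M *ᵥ u))
    {u : ι → ℝ} {c : ℝ} (hu : M *ᵥ u = c • (D *ᵥ ρ)) :
    c = 0 ∧ ∃ a : ℝ, u = a • ρ := by
  set d : ι → ℝ := D *ᵥ ρ with hd
  have hs : 0 < d ⬝ᵥ ρ := by
    have h := hD.dotProduct_mulVec_pos hρ0
    rw [star_trivial] at h
    rwa [dotProduct_comm]
  have hdne : d ≠ 0 := by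
    intro h0
    rw [h0, zero_dotProduct] at hs
    exact lt_irrefl _ hs
  set a : ℝ := (d ⬝ᵥ u) / (d ⬝ᵥ ρ) with ha
  set ut : ι → ℝ := u - a • ρ with hut
  have horth : d ⬝ᵥ ut = 0 := by
    rw [hut, dotProduct_sub, dotProduct_smul, smul_eq_mul, ha, div_mul_cancel₀ _ hs.ne', sub_self]
  have hMut : M *ᵥ ut = c • d := by
    rw [hut, Matrix.mulVec_sub, Matrix.mulVec_smul, hρ, smul_zero, sub_zero, hu]
  have hform : ut ⬝ᵥ (M *ᵥ ut) = 0 := by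
    rw [hMut, dotProduct_smul, smul_eq_mul, dotProduct_comm, horth, mul_zero]
  have hut0 : ut = 0 := by
    by_contra hne
    have := hpos ut horth hne
    rw [hform] at this
    exact lt_irrefl _ this
  refine ⟨?_, a, ?_⟩
  · have h1 : c • d = 0 := by rw [← hMut, hut0, Matrix.mulVec_zero]
    rcases smul_eq_zero.1 h1 with h | h
    · exact h
    · exact absurd h hdne
  · have : u - a • ρ = 0 := by rw [← hut]; exact hut0
    exact sub_eq_zero.1 this

omit [DecidableEq ι] in
/-- A real SKEW matrix has zero real quadratic form: `uᵀJu = 0`. [folklore] -/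
theorem dotProduct_mulVec_self_eq_zero_of_skew {J : Matrix ι ι ℝ} (hJ : Jᵀ = -J) (u : ι → ℝ) :
    u ⬝ᵥ (J *ᵥ u) = 0 := by
  have h : u ⬝ᵥ (J *ᵥ u) = -(u ⬝ᵥ (J *ᵥ u)) := by
    conv_lhs => rw [Matrix.dotProduct_mulVec, ← Matrix.mulVec_transpose, hJ, Matrix.neg_mulVec, neg_dotProduct,
      dotProduct_comm]
  linarith

omit [DecidableEq ι] in
/-- The quadratic form of `Q + J` equals that of `Q` when `J` is skew. [folklore] -/
theorem dotProduct_add_skew_mulVec_self {Q J : Matrix ι ι ℝ} (hJ : Jᵀ = -J) (u : ι → ℝ) :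
    u ⬝ᵥ ((Q + J) *ᵥ u) = u ⬝ᵥ (Q *ᵥ u) := by
  rw [Matrix.add_mulVec, dotProduct_add, dotProduct_mulVec_self_eq_zero_of_skew hJ, add_zero]

/-- **The gyroscopic spectral lemma, `Q + J` form** (idea-2's L1): `Q` real, `J` real skew, `D ≻ 0`, `(Q + J)ρ = 0`,
`Q`'s quadratic form positive on `{u | (Dρ)ᵀu = 0}` ⇒ every complex solution of `(Q + J) v = −μ·D v`, `v ≠ 0`, has
`Re μ < 0`, or `μ = 0` with `v ∈ ℂρ`. The skew part is never certified. [folklore] -/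
theorem re_eig_neg_or_zero_of_add_skew {Q J D : Matrix ι ι ℝ} (hJ : Jᵀ = -J) (hD : D.PosDef) {ρ : ι → ℝ}
    (hρ : (Q + J) *ᵥ ρ = 0) (hpos : ∀ u : ι → ℝ, (D *ᵥ ρ) ⬝ᵥ u = 0 → u ≠ 0 → 0 < u ⬝ᵥ (Q *ᵥ u))
    {μ : ℂ} {v : ι → ℂ} (hv : v ≠ 0)
    (hev : (Q + J).map ((↑) : ℝ → ℂ) *ᵥ v = -(μ • (D.map ((↑) : ℝ → ℂ) *ᵥ v))) :
    μ.re < 0 ∨ (μ = 0 ∧ ∃ c : ℂ, v = c • fun i => (ρ i : ℂ)) :=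
  re_eig_neg_or_zero_of_posDefOn hD hρ
    (fun u hu hu0 => by rw [dotProduct_add_skew_mulVec_self hJ]; exact hpos u hu hu0) hv hev

omit [DecidableEq ι] in
/-- **No Jordan chain at `0`, `Q + J` form** (the card's «algebraically simple 0 at ρ»): `J` real skew, `D ≻ 0`, `ρ ≠ 0`,
`(Q + J)ρ = 0`, `Q`'s form positive on `{u | (Dρ)ᵀu = 0}` ⇒ `(Q + J)u = c·Dρ` forces `c = 0` and `u ∈ ℝρ`. [folklore] -/
theorem eq_zero_of_generalized_null {Q J D : Matrix ι ι ℝ} (hJ : Jᵀ = -J) (hD : D.PosDef) {ρ : ι → ℝ} (hρ0 : ρ ≠ 0)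
    (hρ : (Q + J) *ᵥ ρ = 0) (hpos : ∀ u : ι → ℝ, (D *ᵥ ρ) ⬝ᵥ u = 0 → u ≠ 0 → 0 < u ⬝ᵥ (Q *ᵥ u))
    {u : ι → ℝ} {c : ℝ} (hu : (Q + J) *ᵥ u = c • (D *ᵥ ρ)) :
    c = 0 ∧ ∃ a : ℝ, u = a • ρ :=
  eq_zero_of_generalized_null_of_posDefOn hD hρ0 hρ
    (fun u hu0 hne => by rw [dotProduct_add_skew_mulVec_self hJ]; exact hpos u hu0 hne) hu

/-- **Matrix form** `A = −η·D⁻¹(Q + J)`, `η > 0`: every complex eigenpair `A v = μ v`, `v ≠ 0`, has `Re μ < 0` or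
(`μ = 0`, `v ∈ ℂρ`), under the hypotheses of `re_eig_neg_or_zero_of_add_skew`. [folklore] -/
theorem re_eig_neg_or_zero_of_inv_mul_form {Q J D : Matrix ι ι ℝ} (hJ : Jᵀ = -J) (hD : D.PosDef) {ρ : ι → ℝ}
    (hρ : (Q + J) *ᵥ ρ = 0) (hpos : ∀ u : ι → ℝ, (D *ᵥ ρ) ⬝ᵥ u = 0 → u ≠ 0 → 0 < u ⬝ᵥ (Q *ᵥ u))
    {η : ℝ} (hη : 0 < η) {μ : ℂ} {v : ι → ℂ} (hv : v ≠ 0)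
    (hAv : (-(η • (D⁻¹ * (Q + J)))).map ((↑) : ℝ → ℂ) *ᵥ v = μ • v) :
    μ.re < 0 ∨ (μ = 0 ∧ ∃ c : ℂ, v = c • fun i => (ρ i : ℂ)) := by
  have hDunit : IsUnit D.det := (isUnit_iff_ne_zero.2 hD.det_pos.ne')
  -- D · A = −η (Q + J) over ℝ
  have hDA : D * (-(η • (D⁻¹ * (Q + J)))) = -(η • (Q + J)) := by
    rw [Matrix.mul_neg, Matrix.mul_smul, Matrix.mul_nonsing_inv_cancel_left _ _ hDunit]
  -- cast to ℂ and apply to v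
  have hcast : D.map ((↑) : ℝ → ℂ) *ᵥ ((-(η • (D⁻¹ * (Q + J)))).map ((↑) : ℝ → ℂ) *ᵥ v)
      = -((η : ℂ) • ((Q + J).map ((↑) : ℝ → ℂ) *ᵥ v)) := by
    rw [Matrix.mulVec_mulVec]
    have hm : D.map ((↑) : ℝ → ℂ) * (-(η • (D⁻¹ * (Q + J)))).map ((↑) : ℝ → ℂ)
        = (-(η • (Q + J))).map ((↑) : ℝ → ℂ) := by
      rw [← hDA]
      have : ∀ X Y : Matrix ι ι ℝ, (X * Y).map ((↑) : ℝ → ℂ) = X.map ((↑) : ℝ → ℂ) * Y.map ((↑) : ℝ → ℂ) :=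
        fun X Y => Matrix.map_mul (L := X) (M := Y) (f := Complex.ofRealHom)
      rw [this]
    rw [hm]
    have hneg : (-(η • (Q + J))).map ((↑) : ℝ → ℂ) = -((η : ℂ) • (Q + J).map ((↑) : ℝ → ℂ)) := by
      ext a b
      simp
    rw [hneg, Matrix.neg_mulVec, Matrix.smul_mulVec]
  rw [hAv, Matrix.mulVec_smul] at hcast
  -- hcast : μ • (Dc v) = −(η • (Q+J)c v)  ⇒  (Q+J)c v = −((μ/η) • Dc v)
  have hη' : (η : ℂ) ≠ 0 := by exact_mod_cast hη.ne'
  have hev : (Q + J).map ((↑) : ℝ → ℂ) *ᵥ v = -((μ / η) • (D.map ((↑) : ℝ → ℂ) *ᵥ v)) := by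
    have h2 : (η : ℂ) • ((Q + J).map ((↑) : ℝ → ℂ) *ᵥ v) = -(μ • (D.map ((↑) : ℝ → ℂ) *ᵥ v)) := by
      rw [hcast, neg_neg]
    have h3 := congr_arg (fun x => (η : ℂ)⁻¹ • x) h2
    simp only [smul_smul, inv_mul_cancel₀ hη', one_smul, smul_neg] at h3
    rw [h3, div_eq_inv_mul]
  rcases re_eig_neg_or_zero_of_add_skew hJ hD hρ hpos hv hev with h | ⟨h0, hc⟩
  · left
    rw [Complex.div_ofReal_re] at h
    exact (div_neg_iff.1 h).resolve_left (fun hh => absurd hh.2 (not_lt.2 hη.le)) |>.1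
  · right
    refine ⟨?_, hc⟩
    rcases div_eq_zero_iff.1 h0 with h | h
    · exact h
    · exact absurd h hη'

omit [DecidableEq ι] in
/-- **P2: the subspace hypothesis from a REDUCED positive definite matrix.** If `d ≠ 0`, `Z : ι × κ` has `dᵀZ = 0` and
`#κ + 1 = #ι`, and `Zᵀ Q Z ≻ 0`, then `Q`'s quadratic form is positive on `d^⊥` (`Z` is injective because `ZᵀQZ ≻ 0`, so
`range Z = d^⊥` by dimension count, and `uᵀQu = yᵀ(ZᵀQZ)y` for `u = Zy`). [folklore] -/
theorem posDefOn_of_reduced_posDef {κ : Type*} [Fintype κ] [DecidableEq κ] {Q : Matrix ι ι ℝ} {d : ι → ℝ}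
    (hd : d ≠ 0) (Z : Matrix ι κ ℝ) (hZ : d ᵥ* Z = 0) (hcard : Fintype.card κ + 1 = Fintype.card ι)
    (hPD : (Zᵀ * Q * Z).PosDef) :
    ∀ u : ι → ℝ, d ⬝ᵥ u = 0 → u ≠ 0 → 0 < u ⬝ᵥ (Q *ᵥ u) := by
  classical
  -- the reduced form
  have hform : ∀ y : κ → ℝ, (Z *ᵥ y) ⬝ᵥ (Q *ᵥ (Z *ᵥ y)) = y ⬝ᵥ ((Zᵀ * Q * Z) *ᵥ y) := by
    intro y
    rw [← Matrix.mulVec_mulVec, ← Matrix.mulVec_mulVec, Matrix.dotProduct_mulVec y Zᵀ,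
      Matrix.vecMul_transpose]
  -- Z is injective
  have hinj : Function.Injective (Z.mulVecLin) := by
    rw [← LinearMap.ker_eq_bot, LinearMap.ker_eq_bot']
    intro y hy
    by_contra hne
    have hp : 0 < star y ⬝ᵥ ((Zᵀ * Q * Z) *ᵥ y) := hPD.dotProduct_mulVec_pos hne
    rw [star_trivial, ← hform] at hp
    have hy' : Z *ᵥ y = 0 := hy
    rw [hy'] at hp
    simp at hp
  -- the functional u ↦ dᵀu and its kernel
  let f : (ι → ℝ) →ₗ[ℝ] ℝ :=
    { toFun := fun u => d ⬝ᵥ u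
      map_add' := fun u w => dotProduct_add d u w
      map_smul' := fun r u => by simp [dotProduct_smul] }
  have hrange_le : LinearMap.range Z.mulVecLin ≤ LinearMap.ker f := by
    rintro u ⟨y, rfl⟩
    simp only [LinearMap.mem_ker, LinearMap.coe_mk, AddHom.coe_mk, Matrix.mulVecLin_apply, f]
    rw [Matrix.dotProduct_mulVec, hZ, zero_dotProduct]
  have hf_range : LinearMap.range f = ⊤ := by
    rcases Ideal.eq_bot_or_top (LinearMap.range f) with h | h
    · exfalso
      have hmem : f d ∈ LinearMap.range f := ⟨d, rfl⟩
      rw [h, Submodule.mem_bot] at hmem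
      have hdd : 0 < d ⬝ᵥ d := by
        rcases Function.ne_iff.1 hd with ⟨i, hi⟩
        calc (0 : ℝ) < d i * d i := mul_self_pos.2 hi
          _ ≤ d ⬝ᵥ d := Finset.single_le_sum (f := fun j => d j * d j) (fun j _ => mul_self_nonneg (d j))
              (Finset.mem_univ i)
      exact absurd hmem (ne_of_gt hdd)
    · exact h
  have hker : Module.finrank ℝ (LinearMap.ker f) = Fintype.card κ := by
    have h1 := LinearMap.finrank_range_add_finrank_ker f
    rw [hf_range, finrank_top, Module.finrank_self, Module.finrank_fintype_fun_eq_card] at h1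
    omega
  have hrank : Module.finrank ℝ (LinearMap.range Z.mulVecLin) = Fintype.card κ := by
    rw [LinearMap.finrank_range_of_inj hinj, Module.finrank_fintype_fun_eq_card]
  have heq : LinearMap.range Z.mulVecLin = LinearMap.ker f :=
    Submodule.eq_of_le_of_finrank_eq hrange_le (by rw [hrank, hker])
  -- conclude
  intro u hu hu0
  have hmem : u ∈ LinearMap.ker f := by simpa [f] using hu
  rw [← heq] at hmem
  obtain ⟨y, hy⟩ := hmem
  have hy' : Z *ᵥ y = u := hy
  have hy0 : y ≠ 0 := by
    rintro rfl
    apply hu0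
    rw [← hy', Matrix.mulVec_zero]
  have hp : 0 < star y ⬝ᵥ ((Zᵀ * Q * Z) *ᵥ y) := hPD.dotProduct_mulVec_pos hy0
  rw [star_trivial, ← hform, hy'] at hp
  exact hp

/-- **Certificate form of the gyroscopic spectral lemma** (P1 ∘ P2): `Q` real, `J` real skew, `D ≻ 0`, `(Q + J)ρ = 0`,
`ρ ≠ 0`, a reduction matrix `Z` with `(Dρ)ᵀZ = 0` and `#cols + 1 = #rows`, and ONE positive definite certificate
`ZᵀQZ ≻ 0` ⇒ every complex solution of `(Q + J)v = −μ D v`, `v ≠ 0`, has `Re μ < 0` or (`μ = 0`, `v ∈ ℂρ`). [folklore] -/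
theorem re_eig_neg_or_zero_of_reduced_posDef {κ : Type*} [Fintype κ] [DecidableEq κ] {Q J D : Matrix ι ι ℝ}
    (hJ : Jᵀ = -J) (hD : D.PosDef) {ρ : ι → ℝ} (hρ0 : ρ ≠ 0) (hρ : (Q + J) *ᵥ ρ = 0)
    (Z : Matrix ι κ ℝ) (hZ : (D *ᵥ ρ) ᵥ* Z = 0) (hcard : Fintype.card κ + 1 = Fintype.card ι)
    (hPD : (Zᵀ * Q * Z).PosDef)
    {μ : ℂ} {v : ι → ℂ} (hv : v ≠ 0)
    (hev : (Q + J).map ((↑) : ℝ → ℂ) *ᵥ v = -(μ • (D.map ((↑) : ℝ → ℂ) *ᵥ v))) :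
    μ.re < 0 ∨ (μ = 0 ∧ ∃ c : ℂ, v = c • fun i => (ρ i : ℂ)) := by
  have hd : D *ᵥ ρ ≠ 0 := by
    intro h
    have hp : 0 < star ρ ⬝ᵥ (D *ᵥ ρ) := hD.dotProduct_mulVec_pos hρ0
    rw [h, dotProduct_zero] at hp
    exact lt_irrefl _ hp
  exact re_eig_neg_or_zero_of_add_skew hJ hD hρ (posDefOn_of_reduced_posDef hd Z hZ hcard hPD) hv hev

end Summit.Ventures.GridStability.Lyapunov

end
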